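import Summits.QuantumFields.YangMills.Theorems.LangevinControlUVLatticeGapInUVUnitsGaugeReduction
import HarnessLib

/-!
# Crux `LatticeGapInUVUnitsC` (stmt-QuantumFields-16206), line `nested-shell-rho-mixing`: gauge reduction of the
# box certificate (Elitzur), and the transfer `stub_boxMixingInv → stub_boxMixing`

Support file for item stmt-QuantumFields-16206 (route `LangevinControlUV` of `YangMills`), line lead c2, 2026-08-17.
The line's one open stub S1 `stub_boxMixing` (skeleton `Cruxes/LatticeGapInUVUnitsC/Lines/nested_shell_rho_mixing.lean`)
asks the conditional-variance inequality `Var F ≤ K ∫ (F − μ[F | ext_D])²` for ALL bounded measurable observables of a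
box `{ℓ | ∀ ν, (ℓ.1 ν − x ν).val < w}` of the torus `(ℤ/(2S+1))⁴`, at margin `D = ⌈Θ/a β⌉₊`. This file proves that it
is enough to have it for GAUGE-INVARIANT box observables once the margin is `≥ 2`:

* `BoxGaugeReduction.boxGaugeReduction` — for `μ = wilsonMeasure r.ρ β`, `D ≥ 2`, `K ≥ 1`, the box inequality for bounded
  measurable gauge-invariant box observables implies it for all bounded measurable box observables (box by box). This is
  the box analogue of the landed slab reduction `stub_gaugeReduction` (`…LatticeGapInUVUnitsGaugeReduction`, line
  femto-slab-nondegeneracy of the parent crux stmt-9366), whose abstract part (`var_le_of_orbit`, the Elitzur orthogonality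
  `integral_orbitAverage_mul` pattern) is reused verbatim; only the geometry changes: every endpoint of a box link has all
  coordinate offsets `< w + 1` (`endpoints_of_box`), while for `D ≥ 2` no endpoint of an exterior link does
  (`endpoints_of_exterior`), so the gauge transformations supported on the sites touching the box fix every exterior link.
* `stub_boxMixing_of_inv` — the reshaped stub S1′ `stub_boxMixingInv` (same statement as S1, restricted to gauge-invariant
  `F`, with the margin bound `2 ≤ ⌈Θ/a β⌉₊` supplied as a hypothesis) implies S1 verbatim: `a β → 0` puts `a β < Θ`
  eventually, which forces `⌈Θ/a β⌉₊ ≥ 2`, and `boxGaugeReduction` removes the gauge-invariance restriction. Margin `1`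
  would NOT do (a single boundary link is Haar-distributed but pinned to `O(β^{-1/2})` by the exterior plaquette through
  it), so this use of `a → 0` inside S1 is genuine.

References: S. Elitzur, Phys. Rev. D 12 (1975) 3978; F. Martinelli, LNM 1717 (1999) §3.
-/

noncomputable section

open MeasureTheory Filter Topology
open Literature.MathematicalPhysics.QuantumFieldTheory Literature.MathematicalPhysics.QuantumLattice
open Summit.QuantumFields.YangMills.Theorems.SusceptibilityToPoincare
  (measurable_orbitAverage abs_orbitAverage_le continuous_gaugeAction_univ gaugeTransform_mul
    isGaugeInvariant_orbitAverage integral_comp_gaugeTransform_wilsonMeasure)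
open Summit.QuantumFields.YangMills.Theorems.LatticeGapInUVUnits.FemtoSlabNondegeneracy.GaugeReduction
  (integrable_of_bdd integrable_bdd_mul integral_condExp_mul_eq var_le_of_orbit gaugeTransform_apply
    gaugeTransform_one)

namespace Summit.QuantumFields.YangMills.Theorems.LatticeGapInUVUnitsC.NestedShell

namespace BoxGaugeReduction

section Geometry

variable {G : Type} [Group G] {S : ℕ}

/-- **Both endpoints of a box link touch the box**, coordinatewise: if the `ν`-offset of the base point from `t` is
`< w`, then the `ν`-offsets of both endpoints are `< w + 1`. [folklore] -/
theorem endpoints_of_box {t : ZMod (2 * S + 1)} {w : ℕ} {e : Edge 4 (2 * S + 1)} (ν : Fin 4)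
    (he : (e.1 ν - t).val < w) :
    (e.1 ν - t).val < w + 1 ∧ ((e.1.shift e.2) ν - t).val < w + 1 := by
  refine ⟨Nat.lt_succ_of_lt he, ?_⟩
  rcases val_shift_apply_sub_eq_or e.1 e.2 ν t with h | h
  · rw [h]; exact Nat.lt_succ_of_lt he
  · rw [h]
    rcases Nat.lt_or_ge ((e.1 ν - t).val + 1) (2 * S + 1) with h1 | h1
    · rw [Nat.mod_eq_of_lt h1]; omega
    · have h2 : (e.1 ν - t).val + 1 = 2 * S + 1 := le_antisymm (ZMod.val_lt _) h1
      rw [h2, Nat.mod_self]; omega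

/-- **No endpoint of an exterior link touches the box** (`D ≥ 2`), coordinatewise: if the `ν`-offset of the base
point from `t − (D−1)` is NOT `< w + 2(D−1)`, then the `ν`-offsets of both endpoints from `t` are not `< w + 1`.
[folklore] -/
theorem endpoints_of_exterior {t : ZMod (2 * S + 1)} {w D : ℕ} (hD : 2 ≤ D) {e : Edge 4 (2 * S + 1)} (ν : Fin 4)
    (he : ¬ (e.1 ν - (t - ((D - 1 : ℕ) : ZMod (2 * S + 1)))).val < w + 2 * (D - 1)) :
    ¬ (e.1 ν - t).val < w + 1 ∧ ¬ ((e.1.shift e.2) ν - t).val < w + 1 := by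
  set u := (e.1 ν - (t - ((D - 1 : ℕ) : ZMod (2 * S + 1)))).val with hu
  have hule : w + 2 * (D - 1) ≤ u := Nat.le_of_not_lt he
  have hult : u < 2 * S + 1 := ZMod.val_lt _
  have hkey : e.1 ν - t = ((u - (D - 1) : ℕ) : ZMod (2 * S + 1)) := by
    have h1 : e.1 ν - t = (e.1 ν - (t - ((D - 1 : ℕ) : ZMod (2 * S + 1)))) - ((D - 1 : ℕ) : ZMod (2 * S + 1)) := by
      ring
    rw [h1, ← ZMod.natCast_zmod_val (e.1 ν - (t - ((D - 1 : ℕ) : ZMod (2 * S + 1)))), ← hu,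
      Nat.cast_sub (by omega : D - 1 ≤ u)]
  have hval : (e.1 ν - t).val = u - (D - 1) := by
    rw [hkey, ZMod.val_cast_of_lt (by omega : u - (D - 1) < 2 * S + 1)]
  refine ⟨by rw [hval]; omega, ?_⟩
  rcases val_shift_apply_sub_eq_or e.1 e.2 ν t with h | h
  · rw [h, hval]; omega
  · rw [h, hval]
    have : u - (D - 1) + 1 < 2 * S + 1 := by omega
    rw [Nat.mod_eq_of_lt this]; omega

variable (x : Fin 4 → ZMod (2 * S + 1)) (w : ℕ)

/-- **On box observables a gauge transformation acts only through its values at the sites touching the box**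
(all coordinate offsets `< w + 1` from the corner `x`). [folklore] -/
theorem apply_gaugeTransform_eq_of_agree {F : GaugeConfig 4 (2 * S + 1) G → ℝ}
    (hF : DependsOn F {ℓ : Edge 4 (2 * S + 1) | ∀ ν, (ℓ.1 ν - x ν).val < w}) {g γ : Site 4 (2 * S + 1) → G}
    (hγ : ∀ y : Site 4 (2 * S + 1), (∀ ν, (y ν - x ν).val < w + 1) → γ y = g y) (U : GaugeConfig 4 (2 * S + 1) G) :
    F (gaugeTransform g U) = F (gaugeTransform γ U) := by
  refine hF fun e he => ?_
  have h1 : ∀ ν, (e.1 ν - x ν).val < w + 1 := fun ν => (endpoints_of_box (S := S) ν (he ν)).1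
  have h2 : ∀ ν, ((e.1.shift e.2) ν - x ν).val < w + 1 := fun ν => (endpoints_of_box (S := S) ν (he ν)).2
  simp only [gaugeTransform_apply, hγ _ h1, hγ _ h2]

/-- **A gauge transformation supported on the sites touching the box fixes every exterior link** (`D ≥ 2`), hence
every exterior observable. [folklore] -/
theorem apply_gaugeTransform_eq_of_exterior {D : ℕ} (hD : 2 ≤ D) {H : GaugeConfig 4 (2 * S + 1) G → ℝ}
    (hH : DependsOn H
      {ℓ : Edge 4 (2 * S + 1) | ∀ ν, (ℓ.1 ν - (x ν - ((D - 1 : ℕ) : ZMod (2 * S + 1)))).val < w + 2 * (D - 1)}ᶜ)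
    {γ : Site 4 (2 * S + 1) → G} (hγ : ∀ y : Site 4 (2 * S + 1), ¬ (∀ ν, (y ν - x ν).val < w + 1) → γ y = 1)
    (U : GaugeConfig 4 (2 * S + 1) G) :
    H (gaugeTransform γ U) = H U := by
  refine hH fun e he => ?_
  have he' : ¬ ∀ ν, (e.1 ν - (x ν - ((D - 1 : ℕ) : ZMod (2 * S + 1)))).val < w + 2 * (D - 1) := he
  obtain ⟨ν, hν⟩ := not_forall.1 he'
  obtain ⟨h1, h2⟩ := endpoints_of_exterior (S := S) (t := x ν) hD (e := e) ν hν
  have h1' : ¬ ∀ κ, (e.1 κ - x κ).val < w + 1 := fun h => h1 (h ν)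
  have h2' : ¬ ∀ κ, ((e.1.shift e.2) κ - x κ).val < w + 1 := fun h => h2 (h ν)
  simp only [gaugeTransform_apply, hγ _ h1', hγ _ h2', one_mul, inv_one, mul_one]

/-- The orbit integrand of a box observable is again a box observable, for every `g`. [folklore] -/
theorem dependsOn_comp_gaugeTransform {F : GaugeConfig 4 (2 * S + 1) G → ℝ}
    (hF : DependsOn F {ℓ : Edge 4 (2 * S + 1) | ∀ ν, (ℓ.1 ν - x ν).val < w}) (g : Site 4 (2 * S + 1) → G) :
    DependsOn (fun U => F (gaugeTransform g U)) {ℓ : Edge 4 (2 * S + 1) | ∀ ν, (ℓ.1 ν - x ν).val < w} :=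
  fun _ _ hUV => hF fun e he => by simp only [gaugeTransform_apply, hUV e he]

end Geometry

section Wilson

variable {G : Type} [Group G] [TopologicalSpace G] [IsTopologicalGroup G] [CompactSpace G]
  [MeasurableSpace G] [BorelSpace G]

/-- **KEY IDENTITY (Elitzur's mechanism, box version).** For `μ = wilsonMeasure r.ρ β` on the torus of side `2S+1`, the
orbit average `F̄ U = ∫ F(U^g) dπ(g)` (`π` the product Haar probability measure of the gauge group) of a bounded measurable
observable `F` of the box `(x, w)`, and every bounded measurable `H` invariant under the gauge transformations supported on
the sites touching the box: `∫ F̄ H dμ = ∫ F H dμ`. [folklore] -/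
theorem integral_orbitAverage_mul (r : LatticeRep G) (β : ℝ) (S : ℕ) (x : Fin 4 → ZMod (2 * S + 1)) (w : ℕ)
    {F : GaugeConfig 4 (2 * S + 1) G → ℝ} (hFm : Measurable F) {M : ℝ} (hbF : ∀ U, |F U| ≤ M)
    (hFd : DependsOn F {ℓ : Edge 4 (2 * S + 1) | ∀ ν, (ℓ.1 ν - x ν).val < w})
    {H : GaugeConfig 4 (2 * S + 1) G → ℝ} (hHm : Measurable H) {M' : ℝ} (hbH : ∀ U, |H U| ≤ M')
    (hH : ∀ γ : Site 4 (2 * S + 1) → G, (∀ y, ¬ (∀ ν, (y ν - x ν).val < w + 1) → γ y = 1) →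
      ∀ U, H (gaugeTransform γ U) = H U) :
    ∫ U, (∫ g, F (gaugeTransform g U) ∂(Measure.pi fun _ : Site 4 (2 * S + 1) => haarProbability G)) * H U
        ∂(wilsonMeasure (d := 4) (L := 2 * S + 1) r.ρ β) =
      ∫ U, F U * H U ∂(wilsonMeasure (d := 4) (L := 2 * S + 1) r.ρ β) := by
  haveI : SecondCountableTopology G :=
    (r.continuous.isClosedEmbedding r.injective).isEmbedding.secondCountableTopology
  set μ : Measure (GaugeConfig 4 (2 * S + 1) G) := wilsonMeasure (d := 4) (L := 2 * S + 1) r.ρ β with hμ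
  set π : Measure (Site 4 (2 * S + 1) → G) := Measure.pi fun _ : Site 4 (2 * S + 1) => haarProbability G with hπ
  haveI : IsProbabilityMeasure μ := isProbabilityMeasure_wilsonMeasure (d := 4) (L := 2 * S + 1) r.ρ r.continuous β
  have hact : Measurable fun p : (Site 4 (2 * S + 1) → G) × GaugeConfig 4 (2 * S + 1) G =>
      gaugeTransform p.1 p.2 :=
    (continuous_gaugeAction_univ (d := 4) (L := 2 * S + 1) (G := G)).measurable
  have hjm : Measurable fun p : GaugeConfig 4 (2 * S + 1) G × (Site 4 (2 * S + 1) → G) =>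
      F (gaugeTransform p.2 p.1) * H p.1 :=
    (hFm.comp (hact.comp measurable_swap)).mul (hHm.comp measurable_fst)
  have hM0 : 0 ≤ M := (abs_nonneg _).trans (hbF 1)
  have hbd : ∀ p : GaugeConfig 4 (2 * S + 1) G × (Site 4 (2 * S + 1) → G),
      ‖F (gaugeTransform p.2 p.1) * H p.1‖ ≤ M * M' := fun p => by
    rw [norm_mul, Real.norm_eq_abs, Real.norm_eq_abs]
    exact mul_le_mul (hbF _) (hbH _) (abs_nonneg _) hM0
  have hint : Integrable (Function.uncurry fun U g => F (gaugeTransform g U) * H U) (μ.prod π) :=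
    Integrable.of_bound hjm.aestronglyMeasurable (M * M') (ae_of_all _ fun p => hbd p)
  have hinner : ∀ g : Site 4 (2 * S + 1) → G, ∫ U, F (gaugeTransform g U) * H U ∂μ = ∫ U, F U * H U ∂μ := by
    intro g
    -- truncate `g` to the sites touching the box
    obtain ⟨γ, hγA, hγ1⟩ : ∃ γ : Site 4 (2 * S + 1) → G,
        (∀ y, (∀ ν, (y ν - x ν).val < w + 1) → γ y = g y) ∧ (∀ y, ¬ (∀ ν, (y ν - x ν).val < w + 1) → γ y = 1) := by
      classical
      exact ⟨fun y => if (∀ ν, (y ν - x ν).val < w + 1) then g y else 1, fun y hy => if_pos hy,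
        fun y hy => if_neg hy⟩
    have hγ : ∀ y, ¬ (∀ ν, (y ν - x ν).val < w + 1) → γ⁻¹ y = 1 := fun y hy => by
      rw [Pi.inv_apply, hγ1 y hy, inv_one]
    calc ∫ U, F (gaugeTransform g U) * H U ∂μ
        = ∫ U, F (gaugeTransform γ U) * H U ∂μ := by
          refine integral_congr_ae (ae_of_all _ fun U => ?_)
          simp only [apply_gaugeTransform_eq_of_agree x w hFd hγA U]
      _ = ∫ U, F (gaugeTransform γ (gaugeTransform γ⁻¹ U)) * H (gaugeTransform γ⁻¹ U) ∂μ :=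
          (integral_comp_gaugeTransform_wilsonMeasure r.ρ β γ⁻¹ (fun U => F (gaugeTransform γ U) * H U)).symm
      _ = ∫ U, F U * H U ∂μ := by
          refine integral_congr_ae (ae_of_all _ fun U => ?_)
          simp only [← gaugeTransform_mul, mul_inv_cancel, gaugeTransform_one, hH _ hγ U]
  calc ∫ U, (∫ g, F (gaugeTransform g U) ∂π) * H U ∂μ
      = ∫ U, (∫ g, F (gaugeTransform g U) * H U ∂π) ∂μ := by
        refine integral_congr_ae (ae_of_all _ fun U => ?_)
        simp only [integral_mul_const]
    _ = ∫ g, (∫ U, F (gaugeTransform g U) * H U ∂μ) ∂π := integral_integral_swap hint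
    _ = ∫ U, F U * H U ∂μ := by simp only [hinner, integral_const, probReal_univ, one_smul]

/-- **Gauge reduction of the box certificate (Elitzur).** For every compact `G`, unitary `r`, coupling `β`, torus `S`,
margin `D ≥ 2` and `K ≥ 1`: the box inequality `Var F ≤ K ∫ (F − μ[F | ext_D])²` for bounded measurable GAUGE-INVARIANT
box observables implies it for ALL bounded measurable box observables (box by box: orbit-average `F`, the three
orthogonality facts from `integral_orbitAverage_mul`, then `var_le_of_orbit`). [folklore] -/
theorem boxGaugeReduction (r : LatticeRep G) (β : ℝ) (S D : ℕ) (K : ℝ)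
    (μ : Measure (GaugeConfig 4 (2 * S + 1) G))
    (hμ0 : μ = (wilsonMeasure r.ρ β : Measure (GaugeConfig 4 (2 * S + 1) G))) (hD : 2 ≤ D) (hK : 1 ≤ K)
    (hGI : ∀ (x : Fin 4 → ZMod (2 * S + 1)) (w : ℕ), w + 2 * D ≤ 2 * S →
      ∀ F : GaugeConfig 4 (2 * S + 1) G → ℝ, Measurable F → (∃ M : ℝ, ∀ U, |F U| ≤ M) → IsGaugeInvariant F →
        DependsOn F {ℓ : Edge 4 (2 * S + 1) | ∀ ν, (ℓ.1 ν - x ν).val < w} →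
          ∫ U, (F U - ∫ V, F V ∂μ) ^ 2 ∂μ ≤ K * ∫ U, (F U - (μ[F|cylinderEvents
            {ℓ : Edge 4 (2 * S + 1) | ∀ ν, (ℓ.1 ν - (x ν - ((D - 1 : ℕ) : ZMod (2 * S + 1)))).val <
              w + 2 * (D - 1)}ᶜ]) U) ^ 2 ∂μ)
    (x : Fin 4 → ZMod (2 * S + 1)) (w : ℕ) (hw : w + 2 * D ≤ 2 * S)
    (F : GaugeConfig 4 (2 * S + 1) G → ℝ) (hFm : Measurable F) (hFb : ∃ M : ℝ, ∀ U, |F U| ≤ M)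
    (hFd : DependsOn F {ℓ : Edge 4 (2 * S + 1) | ∀ ν, (ℓ.1 ν - x ν).val < w}) :
    ∫ U, (F U - ∫ V, F V ∂μ) ^ 2 ∂μ ≤ K * ∫ U, (F U - (μ[F|cylinderEvents
      {ℓ : Edge 4 (2 * S + 1) | ∀ ν, (ℓ.1 ν - (x ν - ((D - 1 : ℕ) : ZMod (2 * S + 1)))).val <
        w + 2 * (D - 1)}ᶜ]) U) ^ 2 ∂μ := by
  subst hμ0
  haveI : SecondCountableTopology G :=
    (r.continuous.isClosedEmbedding r.injective).isEmbedding.secondCountableTopology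
  set μ : Measure (GaugeConfig 4 (2 * S + 1) G) := wilsonMeasure (d := 4) (L := 2 * S + 1) r.ρ β with hμ
  set π : Measure (Site 4 (2 * S + 1) → G) := Measure.pi fun _ : Site 4 (2 * S + 1) => haarProbability G with hπ
  set ext : Set (Edge 4 (2 * S + 1)) :=
    {ℓ : Edge 4 (2 * S + 1) | ∀ ν, (ℓ.1 ν - (x ν - ((D - 1 : ℕ) : ZMod (2 * S + 1)))).val < w + 2 * (D - 1)}ᶜ
    with hext
  haveI : IsProbabilityMeasure μ := isProbabilityMeasure_wilsonMeasure (d := 4) (L := 2 * S + 1) r.ρ r.continuous β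
  have hm : cylinderEvents (X := fun _ : Edge 4 (2 * S + 1) => G) ext ≤
      (MeasurableSpace.pi : MeasurableSpace (GaugeConfig 4 (2 * S + 1) G)) := cylinderEvents_le_pi
  obtain ⟨M, hbF⟩ := hFb
  have hact : Measurable fun p : (Site 4 (2 * S + 1) → G) × GaugeConfig 4 (2 * S + 1) G =>
      gaugeTransform p.1 p.2 :=
    (continuous_gaugeAction_univ (d := 4) (L := 2 * S + 1) (G := G)).measurable
  set Fb : GaugeConfig 4 (2 * S + 1) G → ℝ := fun U => ∫ g, F (gaugeTransform g U) ∂π with hFbdef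
  have hFbm : Measurable Fb := measurable_orbitAverage hact hFm
  have hbFb : ∀ U, |Fb U| ≤ M := abs_orbitAverage_le _ hbF
  have hFbi : IsGaugeInvariant Fb := isGaugeInvariant_orbitAverage F
  have hFbd : DependsOn Fb {ℓ : Edge 4 (2 * S + 1) | ∀ ν, (ℓ.1 ν - x ν).val < w} := by
    intro U V hUV
    simp only [hFbdef]
    exact integral_congr_ae (ae_of_all _ fun g => dependsOn_comp_gaugeTransform x w hFd g hUV)
  have hFi : Integrable F μ := integrable_of_bdd hFm hbF
  have hFbI : Integrable Fb μ := integrable_of_bdd hFbm hbFb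
  have h1 : ∫ U, Fb U ∂μ = ∫ U, F U ∂μ := by
    have := integral_orbitAverage_mul r β S x w hFm hbF hFd (H := fun _ => (1 : ℝ)) measurable_const
      (M' := 1) (fun _ => by simp) (fun _ _ _ => rfl)
    simpa only [mul_one] using this
  have h2 : ∫ U, Fb U * F U ∂μ = ∫ U, Fb U ^ 2 ∂μ := by
    have := integral_orbitAverage_mul r β S x w hFm hbF hFd (H := Fb) hFbm hbFb (fun γ _ U => hFbi γ U)
    calc ∫ U, Fb U * F U ∂μ = ∫ U, F U * Fb U ∂μ := integral_congr_ae (ae_of_all _ fun U => mul_comm _ _)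
      _ = ∫ U, Fb U * Fb U ∂μ := this.symm
      _ = ∫ U, Fb U ^ 2 ∂μ := integral_congr_ae (ae_of_all _ fun U => (sq (Fb U)).symm)
  have h3 : μ[F|cylinderEvents (X := fun _ : Edge 4 (2 * S + 1) => G) ext] =ᵐ[μ]
      μ[Fb|cylinderEvents (X := fun _ : Edge 4 (2 * S + 1) => G) ext] := by
    have hQ : StronglyMeasurable[cylinderEvents (X := fun _ : Edge 4 (2 * S + 1) => G) ext]
        (μ[(fun U => F U - Fb U)|cylinderEvents (X := fun _ : Edge 4 (2 * S + 1) => G) ext]) :=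
      stronglyMeasurable_condExp
    have hQb : ∀ᵐ U ∂μ, |(μ[(fun U => F U - Fb U)|cylinderEvents (X := fun _ : Edge 4 (2 * S + 1) => G) ext]) U| ≤
        M + M :=
      ae_bdd_abs_condExp_of_ae_bdd_abs (ae_of_all _ fun U => (abs_sub _ _).trans (add_le_add (hbF U) (hbFb U)))
    obtain ⟨g₀, hg₀m, hg₀b, hg₀⟩ := exists_stronglyMeasurable_truncation hQ (M + M)
    have hg₀ae : g₀ =ᵐ[μ] μ[(fun U => F U - Fb U)|cylinderEvents (X := fun _ : Edge 4 (2 * S + 1) => G) ext] :=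
      hQb.mono fun U hU => hg₀ U hU
    have hg₀meas : Measurable g₀ := (hg₀m.mono hm).measurable
    have hg₀dep : DependsOn g₀ ext := dependsOn_of_measurable_cylinderEvents_real hg₀m.measurable
    have hg₀inv : ∀ γ : Site 4 (2 * S + 1) → G, (∀ y, ¬ (∀ ν, (y ν - x ν).val < w + 1) → γ y = 1) →
        ∀ U, g₀ (gaugeTransform γ U) = g₀ U := fun γ hγ U =>
      apply_gaugeTransform_eq_of_exterior x w hD hg₀dep hγ U
    have hkey : ∫ U, (F U - Fb U) * g₀ U ∂μ = 0 := by
      have e := integral_orbitAverage_mul r β S x w hFm hbF hFd hg₀meas hg₀b hg₀inv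
      have i1 : Integrable (fun U => F U * g₀ U) μ := by
        simpa only [mul_comm] using integrable_bdd_mul (hg₀meas.aestronglyMeasurable) (ae_of_all _ hg₀b) hFi
      have i2 : Integrable (fun U => Fb U * g₀ U) μ := by
        simpa only [mul_comm] using integrable_bdd_mul (hg₀meas.aestronglyMeasurable) (ae_of_all _ hg₀b) hFbI
      have esub : ∀ U, (F U - Fb U) * g₀ U = F U * g₀ U - Fb U * g₀ U := fun U => by ring
      simp_rw [esub]
      rw [integral_sub i1 i2, e, sub_self]
    have hsq : ∫ U, g₀ U ^ 2 ∂μ = 0 := by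
      have a1 : ∫ U, (μ[(fun U => F U - Fb U)|cylinderEvents (X := fun _ : Edge 4 (2 * S + 1) => G) ext]) U * g₀ U ∂μ =
          ∫ U, (F U - Fb U) * g₀ U ∂μ :=
        integral_condExp_mul_eq hm (f := fun U => F U - Fb U) (hFi.sub hFbI) hg₀m hg₀b
      rw [hkey] at a1
      rw [← a1]
      refine integral_congr_ae (hg₀ae.mono fun U hU => ?_)
      simp only [← hU, sq]
    have hg₀zero : g₀ =ᵐ[μ] 0 := by
      have hi : Integrable (fun U => g₀ U ^ 2) μ :=
        integrable_sq_of_ae_bdd_abs hg₀meas.aestronglyMeasurable (ae_of_all _ hg₀b)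
      have := (integral_eq_zero_iff_of_nonneg (fun U => sq_nonneg (g₀ U)) hi).1 hsq
      filter_upwards [this] with U hU
      simpa using hU
    have hsubae : μ[(fun U => F U - Fb U)|cylinderEvents (X := fun _ : Edge 4 (2 * S + 1) => G) ext] =ᵐ[μ] 0 :=
      hg₀ae.symm.trans hg₀zero
    have hlin : μ[(fun U => F U - Fb U)|cylinderEvents (X := fun _ : Edge 4 (2 * S + 1) => G) ext] =ᵐ[μ]
        μ[F|cylinderEvents (X := fun _ : Edge 4 (2 * S + 1) => G) ext] -
          μ[Fb|cylinderEvents (X := fun _ : Edge 4 (2 * S + 1) => G) ext] :=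
      condExp_sub hFi hFbI _
    filter_upwards [hsubae, hlin] with U h0 hl
    have h' : (μ[F|cylinderEvents (X := fun _ : Edge 4 (2 * S + 1) => G) ext] -
        μ[Fb|cylinderEvents (X := fun _ : Edge 4 (2 * S + 1) => G) ext]) U = 0 := by
      rw [← hl, h0]; rfl
    rw [Pi.sub_apply] at h'
    linarith
  exact var_le_of_orbit hm hFm hFbm hbF hbFb h1 h2 h3 hK (hGI x w hw Fb hFbm ⟨M, hbFb⟩ hFbi hFbd)

end Wilson

end BoxGaugeReduction

/-! ### The transfer `stub_boxMixingInv → stub_boxMixing` (skeleton v4 of the line) -/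

/-- **S1′ ⇒ S1.** The gauge-invariant box certificate at margins `≥ 2` (`stub_boxMixingInv`, the reshaped open stub of
line `nested-shell-rho-mixing`, skeleton v4) implies the registered box certificate `stub_boxMixing` for ALL bounded
measurable box observables: since `a β → 0` and `a β > 0`, eventually `a β < Θ`, i.e. `⌈Θ / a β⌉₊ ≥ 2`; enlarge `β₂`
accordingly and apply `BoxGaugeReduction.boxGaugeReduction` torus by torus. [folklore] -/
theorem stub_boxMixing_of_inv : (∀ (G : Type) [Group G] [TopologicalSpace G] [IsTopologicalGroup G] [CompactSpace G], IsCompactSimpleLieGroup G → letI : MeasurableSpace G := borel G; haveI : BorelSpace G := ⟨rfl⟩; ∀ (r : LatticeRep G) (a : ℝ → ℝ), Continuous a → (∃ (Γ : ℝ → ℝ) (β₀ ℓ₀ c C : ℝ), 0 < ℓ₀ ∧ 0 < c ∧ (∀ β, 0 < a β) ∧ Filter.Tendsto a Filter.atTop (nhds 0) ∧ (∀ s : ℝ, 0 < s → s ≤ ℓ₀ → 0 < Γ s ∧ Γ s ≤ 1) ∧ ∀ (L : ℕ) [NeZero L] (β : ℝ), β₀ ≤ β → (L : ℝ) * a β ≤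 ℓ₀ → let P : (Fin 4 → ZMod L) → Fin 4 → Fin 4 → GaugeConfig 4 L G → ℝ := fun x i j U => (r.N : ℝ) - (r.ρ (plaquetteHolonomy U x i j)).trace.re; let E : (GaugeConfig 4 L G → ℝ) → ℝ := fun F => wilsonExpectation (d := 4) (L := L) r.ρ β F; let cov : (GaugeConfig 4 L G → ℝ) → (GaugeConfig 4 L G → ℝ) → ℝ := fun F F' => E (fun U => F U * F' U) - E F * E F'; let dist : (Fin 4 → ZMod L) → (Fin 4 → ZMod L) → ℝ := fun x y => Real.sqrt (∑ k : Fin 4, (((x k - y k).valMinAbs : ℤ) : ℝ) ^ 2); (∀ n : ℕ, 1 ≤ n → 8 * n ≤ L → c * Γ ((n : ℝ) * a β) ≤ (n : ℝ) ^ 8 * cov (P 0 0 1) (P (Pi.single (2 : Fin 4) ((n : ℕ) : ZMod L)) 0 1) ∧ (n : ℝ) ^ 8 * cov (P 0 0 1) (P (Pi.single (2 : Fin 4) ((n : ℕ) : ZMod L)) 0 1) ≤ C * Γ ((n : ℝ) * a β)) ∧ (∀ (x y : Fin 4 → ZMod L) (i j i' j' : Fin 4), x ≠ y → i ≠ j →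 i' ≠ j' → |cov (P x i j) (P y i' j')| * dist x y ^ 8 ≤ C * Γ (dist x y * a β))) → ∃ (Θ K β₂ : ℝ) (S₁ : ℝ → ℕ), 0 < Θ ∧ 1 ≤ K ∧ ∀ β : ℝ, β₂ ≤ β → 2 ≤ ⌈Θ / a β⌉₊ → ∀ S : ℕ, S₁ β ≤ S → ∀ (μ : Measure (GaugeConfig 4 (2 * S + 1) G)), μ = (wilsonMeasure r.ρ β : Measure (GaugeConfig 4 (2 * S + 1) G)) → ∀ (x : Fin 4 → ZMod (2 * S + 1)) (w : ℕ), w + 2 * ⌈Θ / a β⌉₊ ≤ 2 * S → ∀ F : GaugeConfig 4 (2 * S + 1) G → ℝ, Measurable F → (∃ M : ℝ, ∀ U, |F U| ≤ M) → IsGaugeInvariant F → DependsOn F {ℓ : Edge 4 (2 * S + 1) | ∀ ν, (ℓ.1 ν - x ν).val < w} → ∫ U, (F U - ∫ V, F V ∂μ) ^ 2 ∂μ ≤ K * ∫ U, (F U - (μ[F|cylinderEvents {ℓ : Edge 4 (2 * S + 1) | ∀ ν, (ℓ.1 ν - (x ν - ((⌈Θ / a β⌉₊ - 1 : ℕ)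 : ZMod (2 * S + 1)))).val < w + 2 * (⌈Θ / a β⌉₊ - 1)}ᶜ]) U) ^ 2 ∂μ) → ∀ (G : Type) [Group G] [TopologicalSpace G] [IsTopologicalGroup G] [CompactSpace G], IsCompactSimpleLieGroup G → letI : MeasurableSpace G := borel G; haveI : BorelSpace G := ⟨rfl⟩; ∀ (r : LatticeRep G) (a : ℝ → ℝ), Continuous a → (∃ (Γ : ℝ → ℝ) (β₀ ℓ₀ c C : ℝ), 0 < ℓ₀ ∧ 0 < c ∧ (∀ β, 0 < a β) ∧ Filter.Tendsto a Filter.atTop (nhds 0) ∧ (∀ s : ℝ, 0 < s → s ≤ ℓ₀ → 0 < Γ s ∧ Γ s ≤ 1) ∧ ∀ (L : ℕ) [NeZero L] (β : ℝ), β₀ ≤ β → (L : ℝ) * a β ≤ ℓ₀ → let P : (Fin 4 → ZMod L) → Fin 4 → Fin 4 → GaugeConfig 4 L G → ℝ := fun x i j U => (r.N : ℝ) - (r.ρ (plaquetteHolonomy U x i j)).trace.re; let E : (GaugeConfig 4 L G → ℝ) → ℝ := fun F => wilsonExpectation (d := 4) (L := L) r.ρ β F; let cov : (GaugeConfig 4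 L G → ℝ) → (GaugeConfig 4 L G → ℝ) → ℝ := fun F F' => E (fun U => F U * F' U) - E F * E F'; let dist : (Fin 4 → ZMod L) → (Fin 4 → ZMod L) → ℝ := fun x y => Real.sqrt (∑ k : Fin 4, (((x k - y k).valMinAbs : ℤ) : ℝ) ^ 2); (∀ n : ℕ, 1 ≤ n → 8 * n ≤ L → c * Γ ((n : ℝ) * a β) ≤ (n : ℝ) ^ 8 * cov (P 0 0 1) (P (Pi.single (2 : Fin 4) ((n : ℕ) : ZMod L)) 0 1) ∧ (n : ℝ) ^ 8 * cov (P 0 0 1) (P (Pi.single (2 : Fin 4) ((n : ℕ) : ZMod L)) 0 1) ≤ C * Γ ((n : ℝ) * a β)) ∧ (∀ (x y : Fin 4 → ZMod L) (i j i' j' : Fin 4), x ≠ y → i ≠ j → i' ≠ j' → |cov (P x i j) (P y i' j')| * dist x y ^ 8 ≤ C * Γ (dist x y * a β))) → ∃ (Θ K β₂ : ℝ) (S₁ : ℝ → ℕ), 0 < Θ ∧ 1 ≤ K ∧ ∀ β : ℝ, β₂ ≤ β → ∀ S : ℕ, S₁ β ≤ S → ∀ (μ : Measure (GaugeConfig 4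 (2 * S + 1) G)), μ = (wilsonMeasure r.ρ β : Measure (GaugeConfig 4 (2 * S + 1) G)) → ∀ (x : Fin 4 → ZMod (2 * S + 1)) (w : ℕ), w + 2 * ⌈Θ / a β⌉₊ ≤ 2 * S → ∀ F : GaugeConfig 4 (2 * S + 1) G → ℝ, Measurable F → (∃ M : ℝ, ∀ U, |F U| ≤ M) → DependsOn F {ℓ : Edge 4 (2 * S + 1) | ∀ ν, (ℓ.1 ν - x ν).val < w} → ∫ U, (F U - ∫ V, F V ∂μ) ^ 2 ∂μ ≤ K * ∫ U, (F U - (μ[F|cylinderEvents {ℓ : Edge 4 (2 * S + 1) | ∀ ν, (ℓ.1 ν - (x ν - ((⌈Θ / a β⌉₊ - 1 : ℕ) : ZMod (2 * S + 1)))).val < w + 2 * (⌈Θ / a β⌉₊ - 1)}ᶜ]) U) ^ 2 ∂μ := by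
  intro hInv G _ _ _ _ hG
  letI : MeasurableSpace G := borel G
  haveI : BorelSpace G := ⟨rfl⟩
  intro r a ha hP
  obtain ⟨Θ, K, β₂, S₁, hΘ, hK, h⟩ := hInv G hG r a ha hP
  obtain ⟨Γ, β₀, ℓ₀, c, C, -, -, hpos, hlim, -, -⟩ := hP
  obtain ⟨b, hb⟩ : ∃ b : ℝ, ∀ β, b ≤ β → a β < Θ :=
    Filter.eventually_atTop.1 (hlim.eventually (gt_mem_nhds hΘ))
  refine ⟨Θ, K, max β₂ b, S₁, hΘ, hK, ?_⟩
  intro β hβ S hS μ hμ x w hw F hFm hFb hFd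
  have hβ₂ : β₂ ≤ β := le_of_max_le_left hβ
  have hbβ : b ≤ β := le_of_max_le_right hβ
  have hD : 2 ≤ ⌈Θ / a β⌉₊ := by
    have ha0 : 0 < a β := hpos β
    have h1 : (1 : ℝ) < Θ / a β := by
      rw [lt_div_iff₀ ha0, one_mul]; exact hb β hbβ
    have h2 : 1 < ⌈Θ / a β⌉₊ := Nat.lt_ceil.2 (by exact_mod_cast h1)
    omega
  exact BoxGaugeReduction.boxGaugeReduction r β S ⌈Θ / a β⌉₊ K μ hμ hD hK (h β hβ₂ hD S hS μ hμ) x w hw F hFm hFb hFd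

end Summit.QuantumFields.YangMills.Theorems.LatticeGapInUVUnitsC.NestedShell

end
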